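import Mathlib
import Summits.NavierStokesRegularity.NavierStokesRegularity.Theorems.EulerZoomLiouvillePowerGaugeEulerLiouvilleDSSNodeSpectralTrichotomy
import Summits.NavierStokesRegularity.NavierStokesRegularity.Theorems.EulerZoomLiouvillePowerGaugeEulerLiouvilleDSSNodeCocycleKill
import Summits.NavierStokesRegularity.NavierStokesRegularity.Theorems.EulerZoomLiouvillePowerGaugeEulerLiouvilleDSSCountableNodesMember
import HarnessLib.Audit

/-!
# Crux E `PowerGaugeEulerLiouville` (stmt-NavierStokesRegularity-19832): EVERY PERMANENT NODE IS THIN OR KILLS — the DSS Bernoulli-clocked stratum with countably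
# many permanent nodes needs NO node clause at all (width seat ns-cas-k2 g3, lane «DSS thin vortical nodes», tool E part 4 = the clause-free member)

Route `EulerZoomLiouville` (NavierStokesRegularity), crux E.  Assembly of the lane: at a permanent node `x*` of an `l`-DSS classical member in the window `ρ > 0` the
rescaled period map `F` has `det DF(x*) = l³ < lT`, and the spectral trichotomy (…DSSNodeSpectralTrichotomy) gives: a dominated contracting splitting of a power of
`DF(x*)` or of `D(F∘F)(x*)` — then the backward basin of the node along the phase lattice is NULL (tool A, for `F` or `F∘F`) — or `‖DF(x*)^{k₀}‖ < (lT)^{k₀}` — then every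
Type-I trajectory converging to the node carries no vorticity (tool D, the cocycle kill).  Hence:
* **`volume_basin_eq_zero_or_normPow_lt`** — node level: null basin OR the cocycle-kill condition;
* **`ae_eq_zero_of_gauge_of_dss_of_clock_countableNodes_noClause`** — MEMBER: crux hypotheses (every `ρ > 0`) + classical + `l`-DSS (`u`- and `p`-laws) + tame + pressure
  clock `θ < 1` + COUNTABLY many permanent nodes in every ball `‖y‖ ≤ R` ⇒ `u = 0` a.e.  No subcriticality clause at any node (compare the wired
  `ae_eq_zero_of_gauge_of_dss_of_clock_finiteNodes`, whose `hnodes` binder is hereby discharged, and g2's `…_depletion`).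

WHAT THIS IS NOT: not NS regularity, not the crux E — a stratum of hypothetical DSS blow-up members (the pressure clock and the countability of the exactly self-similar
particle paths are genuine hypotheses); 19832 is OPEN. [folklore; Chae2010 (DSS setting); Robinson1999 Ch. V §5.10.1]
-/

noncomputable section

set_option linter.dupNamespace false

open MeasureTheory Set Filter Topology Metric Function
open scoped NNReal ENNReal ContDiff InnerProductSpace RealInnerProductSpace

namespace Summit.NavierStokesRegularity.NavierStokesRegularity.Theorems.PowerGaugeEulerLiouville.DSSNodes

open Literature.Analysis Literature.Analysis.FluidPDE Literature.Analysis.FunctionSpaces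
open Summit.NavierStokesRegularity.NavierStokesRegularity.Theorems.PowerGaugeEulerLiouville.SimilarityBernoulli
open Summit.NavierStokesRegularity.NavierStokesRegularity.Theorems.PowerGaugeEulerLiouville.VorticityBirth
open Summit.NavierStokesRegularity.NavierStokesRegularity.Theorems.PowerGaugeEulerLiouville.MovingSpherePiercing

variable {u : ℝ → EuclideanSpace ℝ (Fin 3) → EuclideanSpace ℝ (Fin 3)} {p : ℝ → EuclideanSpace ℝ (Fin 3) → ℝ} {θ ρ l : ℝ}

/-! ### Node level: null basin or the cocycle-kill condition -/

/-- **EVERY PERMANENT NODE IS THIN OR KILLS.**  `u` classical Euler on `(−∞,0)` with the Cauchy–Lipschitz hypotheses, `l`-DSS (`l > 1`, `ρ > 0`, `T = l^{2+ρ}`), `y*` a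
permanent node, `τ₀ < 0`, `x* = (−τ₀)ⁿy*`, `F(x) = φ(τ₀,Tτ₀,lx)`.  Then either the backward basin of the node along the phase lattice is Lebesgue-null, or
`‖DF(x*)^{k₀}‖ < (lT)^{k₀}` for some `k₀ ≥ 1`. [folklore] -/
theorem volume_basin_eq_zero_or_normPow_lt (hcl : IsClassicalEulerSolutionOn (Iio 0) 0 u p) (hL : ODE.IsUniformlyLipschitzOn u (Iio 0))
    (hl : 1 < l) (hρ : 0 < ρ) (hdss : ∀ τ : ℝ, τ < 0 → ∀ y, u τ y = (l ^ (1 + ρ)) • u ((l ^ (2 + ρ)) * τ) (l • y))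
    {ys : EuclideanSpace ℝ (Fin 3)}
    (hnode : ∀ t : ℝ, t < 0 → u t ((-t) ^ (2 + ρ)⁻¹ • ys) = (-((2 + ρ)⁻¹ * (-t) ^ ((2 + ρ)⁻¹ - 1))) • ys)
    {τ₀ : ℝ} (hτ₀ : τ₀ < 0) :
    volume {x : EuclideanSpace ℝ (Fin 3) |
        Tendsto (fun j : ℕ => (l ^ j)⁻¹ • ODE.evolutionMap u τ₀ ((l ^ (2 + ρ)) ^ j * τ₀) x) atTop (𝓝 ((-τ₀) ^ (2 + ρ)⁻¹ • ys))} = 0 ∨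
      ∃ k₀ : ℕ, 0 < k₀ ∧
        ‖(fderiv ℝ (fun x : EuclideanSpace ℝ (Fin 3) => ODE.evolutionMap u (l ^ (2 + ρ) * τ₀) τ₀ (l • x)) ((-τ₀) ^ (2 + ρ)⁻¹ • ys)) ^ k₀‖ <
          (l * l ^ (2 + ρ)) ^ k₀ := by
  have hl0 : 0 < l := zero_lt_one.trans hl
  have hρ2 : 0 < 2 + ρ := by linarith
  set n : ℝ := (2 + ρ)⁻¹ with hn
  set T : ℝ := l ^ (2 + ρ) with hT
  have hT1 : 1 < T := Real.one_lt_rpow hl hρ2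
  have hT0 : 0 < T := zero_lt_one.trans hT1
  set xs : EuclideanSpace ℝ (Fin 3) := (-τ₀) ^ n • ys with hxs
  obtain ⟨hF, hfix, -, hMdet⟩ := fderiv_periodMap_node hcl hL hl hρ2 hdss hnode hτ₀
  rw [← hT] at hF hfix hMdet
  rw [← hn, ← hxs] at hfix hMdet
  set F : EuclideanSpace ℝ (Fin 3) → EuclideanSpace ℝ (Fin 3) := fun x => ODE.evolutionMap u (T * τ₀) τ₀ (l • x) with hFdef
  set M : EuclideanSpace ℝ (Fin 3) →L[ℝ] EuclideanSpace ℝ (Fin 3) := fderiv ℝ F xs with hMdef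
  have hlam : 1 < l * T := by nlinarith
  have hdet0 : 0 < M.det := by rw [hMdet]; positivity
  have hdet : M.det < l * T := by
    rw [hMdet, hT]
    have h3 : l ^ 3 = l * l ^ (2 : ℝ) := by
      rw [show (2 : ℝ) = ((2 : ℕ) : ℝ) by norm_num, Real.rpow_natCast]; ring
    rw [h3]
    exact mul_lt_mul_of_pos_left (Real.rpow_lt_rpow_of_exponent_lt hl (by linarith)) hl0
  -- the basin consists of points with an `F`-past history converging to `xs`
  set Bset : Set (EuclideanSpace ℝ (Fin 3)) := {x | Tendsto (fun j : ℕ => (l ^ j)⁻¹ • ODE.evolutionMap u τ₀ (T ^ j * τ₀) x) atTop (𝓝 xs)}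
    with hBset
  have hlat : ∀ x (j : ℕ), F ((l ^ (j + 1))⁻¹ • ODE.evolutionMap u τ₀ (T ^ (j + 1) * τ₀) x) = (l ^ j)⁻¹ • ODE.evolutionMap u τ₀ (T ^ j * τ₀) x :=
    fun x j => periodMap_lattice hL hl hρ2 hdss hτ₀ x j
  rcases spectral_trichotomy M hdet0 hlam hdet with hT1' | hT2 | ⟨k₀, hk₀, hk⟩
  · -- (T1): null basin via `F`
    left
    obtain ⟨Es, Ec, k, a, b, hcompl, hs, hc, hEc, hk, ha1, hab, hcon, hdom⟩ := hT1'
    have hnull := addHaar_pastHistorySet_eq_zero_of_dominated_pow (volume : Measure (EuclideanSpace ℝ (Fin 3)))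
      hF hfix hcompl hs hc hk ha1 hab hcon hdom hEc
    refine measure_mono_null (fun x hx => ?_) hnull
    exact ⟨fun j => (l ^ j)⁻¹ • ODE.evolutionMap u τ₀ (T ^ j * τ₀) x, by simp [ODE.evolutionMap_self], fun j => hlat x j, hx⟩
  · -- (T2): null basin via `F ∘ F`
    left
    obtain ⟨Es, Ec, k, a, b, hcompl, hs, hc, hEc, hk, ha1, hab, hcon, hdom⟩ := hT2
    have hF2 : ContDiff ℝ 1 (F ∘ F) := hF.comp hF
    have hfix2 : (F ∘ F) xs = xs := by simp [Function.comp, hfix]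
    have hFd : Differentiable ℝ F := hF.differentiable one_ne_zero
    have hD2 : fderiv ℝ (F ∘ F) xs = M * M := by
      rw [fderiv_comp xs (by rw [hfix]; exact (hFd xs)) (hFd xs), hfix, ContinuousLinearMap.mul_def]
    rw [← hD2] at hs hc hcon hdom
    have hnull := addHaar_pastHistorySet_eq_zero_of_dominated_pow (volume : Measure (EuclideanSpace ℝ (Fin 3)))
      hF2 hfix2 hcompl hs hc hk ha1 hab hcon hdom hEc
    refine measure_mono_null (fun x hx => ?_) hnull
    refine ⟨fun j => (l ^ (2 * j))⁻¹ • ODE.evolutionMap u τ₀ (T ^ (2 * j) * τ₀) x, by simp [ODE.evolutionMap_self], fun j => ?_, ?_⟩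
    · show F (F ((l ^ (2 * (j + 1)))⁻¹ • ODE.evolutionMap u τ₀ (T ^ (2 * (j + 1)) * τ₀) x)) =
        (l ^ (2 * j))⁻¹ • ODE.evolutionMap u τ₀ (T ^ (2 * j) * τ₀) x
      rw [show 2 * (j + 1) = (2 * j + 1) + 1 by ring, hlat x (2 * j + 1), hlat x (2 * j)]
    · have hx' : Tendsto (fun j : ℕ => (l ^ j)⁻¹ • ODE.evolutionMap u τ₀ (T ^ j * τ₀) x) atTop (𝓝 xs) := hx
      exact hx'.comp (tendsto_id.const_mul_atTop' (by norm_num : 0 < 2))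
  · -- (T3): the cocycle-kill condition
    right
    exact ⟨k₀, hk₀, hk⟩

/-! ### The clause-free member theorem -/

/-- **TAME DSS MEMBERS WITH A SUB-BERNOULLI PRESSURE CLOCK AND COUNTABLY MANY PERMANENT NODES PER BALL ARE TRIVIAL — NO NODE CLAUSE.**  Crux hypotheses verbatim
(every `ρ > 0`) + classical + `u(τ,y) = l^{1+ρ}u(l^{2+ρ}τ, ly)`, `p(τ,y) = l^{2+2ρ}p(l^{2+ρ}τ, ly)` (`l > 1`) + `u`, `∇u` bounded on compact time intervals + the pressure
clock `(−s)∂ₛp − n⟪∇p,x⟩ − 2(1−n)p ≤ θ(1−2n)‖u + (n/(−s))x‖²` (`θ < 1`) + for every `R` the permanent nodes `y*` (`u(t,(−t)ⁿy*) = −n(−t)^{n−1}y*` for all `t < 0`)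
with `‖y*‖ ≤ R` are COUNTABLY MANY ⇒ `u = 0` a.e. on `(−∞,0) × ℝ³`.  Mechanism: every confined backward trajectory rests (clock) and converges along the phase lattice to
one permanent node (connected cluster set, countable nodes); that node is THIN (null basin: dominated splitting of the period map or of its square) or KILLS (cocycle
condition `‖DF^{k₀}‖ < (lT)^{k₀}`, Type-I vorticity along the trajectory); so the confined vortical set is null and g0's irrotational endgame applies. [folklore] -/
theorem ae_eq_zero_of_gauge_of_dss_of_clock_countableNodes_noClause (hρ : 0 < ρ)
    {H : ℝ → EuclideanSpace ℝ (Fin 3) → EuclideanSpace ℝ (Fin 3) →L[ℝ] EuclideanSpace ℝ (Fin 3)} {c₀ : ℝ≥0}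
    (hsw : IsSuitableWeakSolutionOn (slab (EuclideanSpace ℝ (Fin 3)) (Iio 0) isOpen_Iio) 0 0 u p)
    (hH : HasWeakSpatialGradientOn (slab (EuclideanSpace ℝ (Fin 3)) (Iio 0) isOpen_Iio) u H)
    (hgauge : ∀ a : ℝ, 0 < a →
      ENNReal.ofReal (a ^ (2 * ρ)) * cknA a (0 : ℝ × EuclideanSpace ℝ (Fin 3)) u +
          ENNReal.ofReal (a ^ ρ) * cknE a (0 : ℝ × EuclideanSpace ℝ (Fin 3)) H +
        ENNReal.ofReal (a ^ (2 * ρ)) * cknD a (0 : ℝ × EuclideanSpace ℝ (Fin 3)) p ≤ (c₀ : ℝ≥0∞))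
    (hcl : IsClassicalEulerSolutionOn (Iio 0) 0 u p) (hl : 1 < l)
    (hdss : ∀ τ : ℝ, τ < 0 → ∀ y, u τ y = (l ^ (1 + ρ)) • u ((l ^ (2 + ρ)) * τ) (l • y))
    (hpdss : ∀ τ : ℝ, τ < 0 → ∀ y, p τ y = l ^ (2 + 2 * ρ) * p ((l ^ (2 + ρ)) * τ) (l • y))
    (htame : ∀ s t : ℝ, s < t → t < 0 → ∃ B : ℝ, ∀ τ ∈ Icc s t, ∀ y : EuclideanSpace ℝ (Fin 3),
      ‖u τ y‖ ≤ B ∧ ‖fderiv ℝ (u τ) y‖ ≤ B)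
    (hθ : θ < 1)
    (hclock : ∀ s : ℝ, s < 0 → ∀ x : EuclideanSpace ℝ (Fin 3),
      (-s) * timeDerivWithin (Iio 0) p s x - (2 + ρ)⁻¹ * fderiv ℝ (p s) x x - 2 * (1 - (2 + ρ)⁻¹) * p s x ≤
        θ * (1 - 2 * (2 + ρ)⁻¹) * ‖u s x + ((2 + ρ)⁻¹ / (-s)) • x‖ ^ 2)
    (hcount : ∀ R : ℝ, {y : EuclideanSpace ℝ (Fin 3) | ‖y‖ ≤ R ∧
      ∀ t : ℝ, t < 0 → u t ((-t) ^ (2 + ρ)⁻¹ • y) = (-((2 + ρ)⁻¹ * (-t) ^ ((2 + ρ)⁻¹ - 1))) • y}.Countable) :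
    uncurry u =ᵐ[volume.restrict (Iio (0 : ℝ) ×ˢ (univ : Set (EuclideanSpace ℝ (Fin 3))))] 0 := by
  have hρ2 : 0 < 2 + ρ := by linarith
  have hl0 : 0 < l := zero_lt_one.trans hl
  set n : ℝ := (2 + ρ)⁻¹ with hn
  have hn0 : 0 ≤ n := (inv_pos.2 hρ2).le
  have hn0' : 0 < n := inv_pos.2 hρ2
  have hn2 : n < 1 / 2 := by
    rw [hn, inv_lt_comm₀ hρ2 (by norm_num)]; norm_num; linarith
  set T : ℝ := l ^ (2 + ρ) with hT
  have hT1 : 1 < T := Real.one_lt_rpow hl hρ2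
  have hT0 : 0 < T := zero_lt_one.trans hT1
  obtain ⟨B, hB⟩ := htame (-T) (-1) (by linarith) (by norm_num)
  have hK := exists_typeI_of_dss_tame hl hρ2 (by linarith) hdss hB
  set K : ℝ := T * B with hKdef
  have hΛc : ContinuousOn (fun s : ℝ => K / (-s)) (Iio 0) :=
    continuousOn_const.div continuousOn_neg fun s hs => by rw [mem_Iio] at hs; linarith
  have hΛ : ∀ s : ℝ, s < 0 → ∀ y, ‖fderiv ℝ (u s) y‖ ≤ K / (-s) := fun s hs y => by
    rw [le_div_iff₀ (by linarith), mul_comm]; exact (hK s hs y).1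
  have hlip : ODE.IsUniformlyLipschitzOn u (Iio 0) := isUniformlyLipschitzOn hcl hΛc hΛ
  refine ae_eq_zero_of_gauge_of_piercing_of_confinedNull_allRho (n := n) hρ hsw hH hgauge hcl hΛc hΛ
    (fun R₀ => ?_) (fun τ₀ hτ₀ R hR => ?_)
  · set R : ℝ := max R₀ (K / n + 1) with hRdef
    have hbR : K < n * R := by
      have h1 : K / n + 1 ≤ R := le_max_right _ _
      have h2 : K / n < R := by linarith
      rwa [div_lt_iff₀ hn0', mul_comm] at h2
    exact ⟨R, le_max_left _ _, fun σ hσ x hx hfast =>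
      absurd hfast (not_le.2 (noFastInflow_of_boundedSpeed hσ hbR (fun y _ => (hK σ hσ y).2) hx))⟩
  · obtain ⟨P₀, G, hPG⟩ := exists_pressure_core_bounds_of_dss hcl.smooth_pressure hl hρ2 hpdss R
    set N : Set (EuclideanSpace ℝ (Fin 3)) := {y | ‖y‖ ≤ R ∧
      ∀ t : ℝ, t < 0 → u t ((-t) ^ n • y) = (-(n * (-t) ^ (n - 1))) • y} with hNdef
    -- every confined trajectory converges along the phase lattice to a permanent node of the ball
    have hsub : {x : EuclideanSpace ℝ (Fin 3) | curl (u τ₀) x ≠ 0 ∧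
        ∀ σ : ℝ, σ ≤ τ₀ → ‖ODE.evolutionMap u τ₀ σ x‖ < R * (-σ) ^ n} ⊆
        ⋃ ys ∈ N, {x : EuclideanSpace ℝ (Fin 3) | curl (u τ₀) x ≠ 0 ∧
          Tendsto (fun j : ℕ => (l ^ j)⁻¹ • ODE.evolutionMap u τ₀ (T ^ j * τ₀) x) atTop (𝓝 ((-τ₀) ^ n • ys))} := by
      intro x hx
      set X : ℝ → EuclideanSpace ℝ (Fin 3) := fun s => ODE.evolutionMap u τ₀ s x with hX
      have hXd : ∀ s : ℝ, s < 0 → HasDerivAt X (u s (X s)) s := fun s hs =>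
        hlip.hasDerivAt_evolutionMap (convex_Iio 0) hτ₀ (Iio_mem_nhds hs) x
      have hconf' : ∀ s : ℝ, s ≤ τ₀ → ‖X s‖ ≤ R * (-s) ^ n := fun s hs => (hx.2 s hs).le
      have hrest := tendsto_similaritySpeed_zero_of_clock hcl hn0 hn2 hθ hclock hτ₀ hXd hconf'
        (fun s hs => (hK s (by linarith) (X s)).2) (fun s hs => (hPG s (by linarith) (X s) (hconf' s hs)).1)
        (fun s hs => (hPG s (by linarith) (X s) (hconf' s hs)).2)
      obtain ⟨ys, hysR, hysN, hlat⟩ := exists_tendsto_lattice_of_countable_nodes hcl hl hρ2 hdss hXd hrest hτ₀ hconf' (hcount R)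
      refine mem_biUnion (show ys ∈ N from ⟨hysR, hysN⟩) ⟨hx.1, ?_⟩
      have hc := hlat.const_smul ((-τ₀) ^ n)
      refine hc.congr fun j => ?_
      simp only [hX]
      have hTj : T ^ j * τ₀ < 0 := mul_neg_of_pos_of_neg (pow_pos hT0 _) hτ₀
      rw [smul_smul, Real.rpow_neg (by linarith) n, hT, ← pow_mul_rpow_eq hl hρ2 j hτ₀, mul_inv,
        show (-τ₀) ^ n * ((l ^ j)⁻¹ * ((-τ₀) ^ n)⁻¹) = (l ^ j)⁻¹ by
          field_simp [(Real.rpow_pos_of_pos (by linarith : (0:ℝ) < -τ₀) n).ne']]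
    refine measure_mono_null hsub ((measure_biUnion_null_iff (hcount R)).2 fun ys hys => ?_)
    -- the node is thin or kills
    rcases volume_basin_eq_zero_or_normPow_lt hcl hlip hl hρ hdss hys.2 hτ₀ with hnull | ⟨k₀, hk₀, hk⟩
    · exact measure_mono_null (fun x hx => hx.2) hnull
    · -- cocycle kill: the piece is empty
      have hempty : {x : EuclideanSpace ℝ (Fin 3) | curl (u τ₀) x ≠ 0 ∧
          Tendsto (fun j : ℕ => (l ^ j)⁻¹ • ODE.evolutionMap u τ₀ (T ^ j * τ₀) x) atTop (𝓝 ((-τ₀) ^ n • ys))} = ∅ := by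
        refine eq_empty_iff_forall_notMem.2 fun x hx => hx.1 ?_
        have hC : ∀ s : ℝ, s ≤ τ₀ → (-s) * ‖curl (u s) (ODE.evolutionMap u τ₀ s x)‖ ≤ 4 * K := by
          intro s hs
          have hs0 : 0 < -s := by linarith
          have h1 := norm_curl_le_four_mul (u s) (ODE.evolutionMap u τ₀ s x)
          have h2 := (hK s (by linarith) (ODE.evolutionMap u τ₀ s x)).1
          calc (-s) * ‖curl (u s) (ODE.evolutionMap u τ₀ s x)‖ ≤ (-s) * (4 * ‖fderiv ℝ (u s) (ODE.evolutionMap u τ₀ s x)‖) :=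
                mul_le_mul_of_nonneg_left h1 hs0.le
            _ = 4 * ((-s) * ‖fderiv ℝ (u s) (ODE.evolutionMap u τ₀ s x)‖) := by ring
            _ ≤ 4 * K := by linarith
        have hq : Tendsto (fun j : ℕ => (l ^ j)⁻¹ • ODE.evolutionMap u τ₀ ((l ^ (2 + ρ)) ^ j * τ₀) x) atTop (𝓝 ((-τ₀) ^ (2 + ρ)⁻¹ • ys)) := by
          rw [← hT]; exact hx.2
        exact curl_eq_zero_of_tendsto_of_normPow_lt hcl hlip hl hρ2 hdss hτ₀ hC hq hk₀ hk
      rw [hempty, measure_empty]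

end Summit.NavierStokesRegularity.NavierStokesRegularity.Theorems.PowerGaugeEulerLiouville.DSSNodes

end
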